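import Literature.Topology.FourManifolds.SphereProductTubeTopology
import Literature.Topology.FourManifolds.SphereProductThomFundamentalClass
import Literature.Topology.FourManifolds.BCSSignatureAdditivity
import Literature.Topology.FourManifolds.ClosedModelAmbientCollapse
import Literature.Topology.FourManifolds.SmaleHomologySpheresHCobordism
import Literature.Topology.FourManifolds.HomotopySpheresE8HandlebodyReduction
import Literature.Topology.FourManifolds.CompatibleOrientationRestrict
import Literature.Topology.FourManifolds.RelFundamentalClassOfInteriorOrientation
import Literature.Topology.FourManifolds.ClosedModelRelOrientation
import Literature.AlgebraicTopology.SingularHomology.FundamentalClassExistence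
import Literature.AlgebraicTopology.SingularHomology.LocalDegreeSign
import HarnessLib

/-!
# Collapsing an oriented closed manifold onto the closed model of a piece, and the tube of
# the diagonal of `Sᵏ × Sᵏ`

Topic `Literature/Topology/FourManifolds` (fact seat of
`Literature.Topology.FourManifolds.HomotopySphere.exists_intersectionForm_equivalent_e8Form`,
Kosinski's `E₈` plumbing `M(4m)`, *Differential Manifolds* (1993), VI.12). Sequel of
`ClosedModelAmbientCollapse.lean` (the collapse `π : X → Ŵ_P` of an ambient space onto the closed
model `Ŵ_P = W_P ∪ cone(∂W_P)` of a piece `int W_P ↪ X`, with its transfer of classes) and of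
`SphereProductTubeTopology.lean` (the tube `N_c = {⟪p, q⟫ ≥ c}` of the diagonal). It supplies the
orientation bookkeeping of the vertex models of the plumbing — all read in ONE oriented copy of
`S²ᵐ × S²ᵐ` — in the language of the tree (`NullCobordism.closedModelClass`,
`IsRelFundamentalClass`, `HomologicalOrientation`):

* `HomologicalOrientation.exists_map_localClass_eq_of_isOpenEmbedding` — **an orientation pulls
  back along an open embedding** `E : Y → X` (`E_* ν_y = μ_{E y}`; Hatcher §3.3 p. 231);
* `NullCobordism.exists_collapse_fundamentalClass` — for `c_P : NullCobordism (m + 1) M_P`, a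
  closed `ℤ`-oriented `(m+2)`-manifold `(X, μ)` and an open embedding `e : int W_P → X`: the
  collapse `π : X → Ŵ_P` and a relative fundamental class `w` of `(W_P, ∂W_P)` INDUCED BY `μ`
  (its interior local classes and `μ` come from one class on `int W_P`) with
  **`π_* [X]_μ = ẑ_w`** (Hatcher Thm. 3.26(a), p. 253, Lemma 3.27; Kervaire–Milnor 1963, §7
  footnote: the closed homology manifold `W ∪ cone(bW)`);
* `SphereProd.Tube.surjective_map_collapse`, `SphereProd.Tube.exists_collapse` — **the collapse
  `Sᵏ × Sᵏ → N̂_c` is onto on `Hₖ`** (`k ≥ 2`; exact sequence of the pair `(Sᵏ × Sᵏ, N')`,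
  `Hₖ₋₁(N') = 0`, Hatcher Prop. 2.22 for `q : (N, ∂N) → (N̂, ∞)`), for every collapse which is
  `q` on the tube and `∞` on `N' = {⟪p, q⟫ ≤ c}`;
* `SphereProd.Tube.exists_collapse_fundamentalClass` — **the collapse carries `[Sᵏ × Sᵏ]_μ` to
  the closed-model class `ẑ_w` of the tube**, `w` the relative fundamental class of
  `(N_c, ∂N_c)` induced by `μ` (the inclusion `N_c ⊆ Sᵏ × Sᵏ` carries its interior local classes
  to those of `μ`): the datum `βᵥ = (πᵥ)_* ẑ` of the Kronecker form of the `E₈` table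
  (`HomotopySpheresE8KroneckerTable.lean`) for the vertex models, to be combined with
  `SphereProductThomKronecker.lean` (`ξ ⌢ c₊[X]_μ = r • c₊(y₁ + y₂)`, `|r| = 1`).

Everything is proved; no definitions, no named facts (D-0026).

## References

* A. Kosinski, *Differential Manifolds* (1993), VI.12, pp. 119–122 (the pieces of `M(4n)` and
  their orientations). [Kosinski1993]
* A. Hatcher, *Algebraic Topology* (2002), §3.3: p. 231, Thm. 3.26(a), Lemma 3.27, p. 253
  (relative fundamental class); Prop. 2.22, Thm. 2.16. [HatcherAT2002]
* M. Kervaire, J. Milnor, *Groups of homotopy spheres I*, Ann. of Math. 77 (1963), §7 footnote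
  pp. 528–529. [KervaireMilnorAnnals1963]
* J. Milnor, *Topology from the Differentiable Viewpoint* (1965), §7 (the Pontryagin collapse).
  [MilnorTDV1965]
-/

open scoped Manifold ContDiff Topology InnerProductSpace
open Set Function CategoryTheory CategoryTheory.Limits Topology

noncomputable section

namespace Literature.Topology.FourManifolds

open Literature.AlgebraicTopology.SingularHomology Literature.Geometry.Manifold

/-! ### Orientations pulled back along open embeddings -/

/-- **An orientation pulls back along an open embedding** (Hatcher 2002, §3.3 p. 231: local
orientations are local): for `E : Y → X` an open embedding into a manifold `X` and a
`ℤ`-orientation `μ` of `X` there is a `ℤ`-orientation `ν` of `Y` with `E_* ν_y = μ_{E y}` for every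
`y` (the restriction `μ|_{E(Y)}` transported along `Y ≅ E(Y)`). [cite: HatcherAT2002, §3.3 p. 231] -/
theorem _root_.Literature.AlgebraicTopology.SingularHomology.HomologicalOrientation.exists_map_localClass_eq_of_isOpenEmbedding
    {X Y : Type} [TopologicalSpace X] [T2Space X] [TopologicalSpace Y] {n : ℕ}
    [ChartedSpace (EuclideanSpace ℝ (Fin n)) X] (μ : HomologicalOrientation ℤ X n)
    (E : C(Y, X)) (hE : IsOpenEmbedding E) :
    ∃ ν : HomologicalOrientation ℤ Y n, ∀ y : Y,
      relativeSingularHomology.map ℤ ℤ E (LocalFamily.mapsTo_compl_pt hE.injective y) n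
        (ν.localClass y) = μ.localClass (E y) := by
  set U : TopologicalSpace.Opens X := ⟨range E, hE.isOpen_range⟩ with hU
  set h : Y ≃ₜ U := hE.isEmbedding.toHomeomorph with hh
  have hhy : ∀ y, (h y : X) = E y := fun y => rfl
  refine ⟨(μ.restrictOpens U).comap h, fun y => ?_⟩
  rw [HomologicalOrientation.comap_localClass]
  -- `E = val ∘ h`
  have hfac : E = (HomologicalOrientation.valC U).comp (h : C(Y, U)) := by
    ext y; rfl
  have hmapsh : MapsTo (h : C(Y, U)) ({y}ᶜ : Set Y) ({h y}ᶜ : Set U) :=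
    LocalFamily.mapsTo_compl_pt h.injective y
  have hmapsv : MapsTo (HomologicalOrientation.valC U) ({h y}ᶜ : Set U) ({E y}ᶜ : Set X) := by
    intro z hz hzy
    exact hz (Subtype.ext ((hhy y).symm ▸ hzy))
  rw [relativeSingularHomology.map_congr_fun' (R := ℤ) hfac
    (LocalFamily.mapsTo_compl_pt hE.injective y) (hmapsv.comp hmapsh) n]
  change relativeSingularHomology.map ℤ ℤ ((HomologicalOrientation.valC U).comp (h : C(Y, U)))
    (hmapsv.comp hmapsh) n ((localHomology.mapIso ℤ ℤ h y n).inv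
      ((μ.restrictOpens U).localClass (h y))) = _
  rw [relativeSingularHomology.map_comp ℤ ℤ (h : C(Y, U)) (HomologicalOrientation.valC U) hmapsh hmapsv n,
    ModuleCat.comp_apply]
  have hinv : relativeSingularHomology.map ℤ ℤ (h : C(Y, U)) hmapsh n
      ((localHomology.mapIso ℤ ℤ h y n).inv ((μ.restrictOpens U).localClass (h y))) =
      (μ.restrictOpens U).localClass (h y) := by
    change ((localHomology.mapIso ℤ ℤ h y n).inv ≫ (localHomology.mapIso ℤ ℤ h y n).hom) _ = _
    rw [Iso.inv_hom_id, ModuleCat.id_apply]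
  rw [hinv]
  exact HomologicalOrientation.map_val_restrictOpens_localClass μ U (h y)

/-! ### The relative fundamental class induced by an ambient orientation, and its closed-model
class as the collapse of the fundamental class -/

namespace NullCobordism

variable {m : ℕ} {MP : Type} [TopologicalSpace MP] [ChartedSpace (EuclideanSpace ℝ (Fin (m + 1))) MP]
  [IsManifold (𝓡 (m + 1)) ∞ MP] [CompactSpace MP] [Nonempty MP]

set_option maxHeartbeats 800000 in
/-- **The collapse carries the fundamental class to the closed-model class.** Let
`c_P : NullCobordism (m + 1) M_P` (so `W_P` is a compact smooth `(m+2)`-manifold with boundary),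
`X` a closed `ℤ`-oriented topological `(m+2)`-manifold with orientation `μ`, and
`e : int W_P → X` an open embedding. Then there are: the collapse `π : X → Ŵ_P` of
`exists_ambientCollapse` (`π (e y) = y`, `π = ∞` off the image), and a relative fundamental
class `w ∈ Hₘ₊₂(W_P, ∂W_P; ℤ)` INDUCED BY `μ` — at every interior point its local class and the
local class `μ_{e y}` come from one class on `int W_P` — such that

  `π_* [X]_μ = ẑ_w`  (the closed-model class of `w`).

Proof: pull `μ` back to `int W_P` along `e`
(`HomologicalOrientation.exists_map_localClass_eq_of_isOpenEmbedding`), take the relative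
fundamental class with these interior local classes
(`exists_isRelFundamentalClass_of_interiorOrientation`, Hatcher p. 253), and transfer along the
collapse (`exists_ambientCollapse`: the local classes of `[X]_μ` at `e y`, Thm. 3.26(a), and of
`ẑ_w` at `y`, `toLocal_closedModelClass_of_mem_interior`, come from the same class). This is the
orientation bookkeeping by which all vertex models of the `E₈` plumbing are read in ONE oriented
copy of `S²ᵐ × S²ᵐ` (Kosinski 1993, VI.12: the pieces of `M(4n)` are oriented coherently).
[cite: Kosinski1993, VI.12 pp. 119–122] [cite: HatcherAT2002, §3.3 Thm. 3.26(a), p. 253, Lemma 3.27] [cite: KervaireMilnorAnnals1963, §7 footnote pp. 528–529] -/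
theorem exists_collapse_fundamentalClass (cP : NullCobordism (m + 1) MP) {X : Type}
    [TopologicalSpace X] [T2Space X] [CompactSpace X]
    [ChartedSpace (EuclideanSpace ℝ (Fin (m + 1 + 1))) X]
    (μ : HomologicalOrientation ℤ X (m + 1 + 1))
    (e : C(ManifoldInterior (m + 1) cP.W, X)) (he : IsOpenEmbedding e) :
    ∃ (π : C(X, ClosedModel (m + 1) cP.W))
      (w : relativeSingularHomology ℤ ℤ cP.W ((𝓡∂ (m + 1 + 1)).boundary cP.W) (m + 1 + 1)),
      (∀ y, π (e y) = ClosedModel.ofInterior y) ∧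
      (∀ x, x ∉ range e → π x = ClosedModel.infty) ∧
      (∀ y, MapsTo π ({e y}ᶜ : Set X) ({ClosedModel.ofInterior y}ᶜ : Set _)) ∧
      IsRelFundamentalClass ℤ ((𝓡∂ (m + 1 + 1)).boundary cP.W) w ∧
      (∀ y : ManifoldInterior (m + 1) cP.W,
        ∃ ζ : localHomology ℤ ℤ (ManifoldInterior (m + 1) cP.W) y (m + 1 + 1),
          relativeSingularHomology.toLocal ℤ ℤ ((𝓡∂ (m + 1 + 1)).boundary cP.W)
              ⟨y.1, by rw [ModelWithCorners.compl_boundary]; exact y.2⟩ (m + 1 + 1) w =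
            relativeSingularHomology.map ℤ ℤ
              (⟨Subtype.val, continuous_subtype_val⟩ : C(ManifoldInterior (m + 1) cP.W, cP.W))
              (LocalFamily.mapsTo_compl_pt Subtype.val_injective y) (m + 1 + 1) ζ ∧
          relativeSingularHomology.map ℤ ℤ e (LocalFamily.mapsTo_compl_pt he.injective y)
            (m + 1 + 1) ζ = μ.localClass (e y) ∧
          singularHomology.toLocal ℤ ℤ (ClosedModel.ofInterior y) (m + 1 + 1)
              (cP.closedModelClass ℤ ℤ (Nat.le_add_left 1 m) w) =
            relativeSingularHomology.map ℤ ℤ (ofInteriorCM cP)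
              (LocalFamily.mapsTo_compl_pt (isOpenEmbedding_ofInteriorCM cP).injective y)
              (m + 1 + 1) ζ) ∧
      singularHomology.map ℤ ℤ π (m + 1 + 1) μ.fundamentalClass =
        cP.closedModelClass ℤ ℤ (Nat.le_add_left 1 m) w := by
  -- the collapse
  have Hπ := cP.exists_ambientCollapse e he
  obtain ⟨π, hπ⟩ := Hπ
  have hπe := hπ.1
  have hπout := hπ.2.1
  have hmaps := hπ.2.2.1
  have htrans := hπ.2.2.2
  -- `θ : Interior ≃ₜ ManifoldInterior (m + 1) W_P` (the two models of the interior)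
  let θ : cP.Interior ≃ₜ ManifoldInterior (m + 1) cP.W :=
    { toFun := fun v => ⟨v.val, v.property⟩
      invFun := fun y => ⟨y.1, y.2⟩
      left_inv := fun _ => rfl
      right_inv := fun _ => rfl
      continuous_toFun := InteriorManifold.continuous_val.subtype_mk _
      continuous_invFun := InteriorManifold.continuous_iff_comp_val.2 continuous_subtype_val }
  let θCM : C(cP.Interior, ManifoldInterior (m + 1) cP.W) := θ
  -- the open embedding `E = e ∘ θ : Interior → X`
  let E : C(cP.Interior, X) := e.comp θCM
  have hEemb : IsOpenEmbedding E := he.comp θ.isOpenEmbedding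
  -- the orientation of the interior and the relative fundamental class it induces
  obtain ⟨ν, hν⟩ := μ.exists_map_localClass_eq_of_isOpenEmbedding E hEemb
  obtain ⟨w, hw, hwloc⟩ := cP.exists_isRelFundamentalClass_of_interiorOrientation ν
  -- `val ∘ θ = valCM`
  have hval : (⟨Subtype.val, continuous_subtype_val⟩ : C(ManifoldInterior (m + 1) cP.W, cP.W)).comp θCM =
      cP.valCM := by
    ext v : 1; rfl
  -- the three local identities at an interior point, for `ζ = θ_* ν_v`
  have hkey : ∀ y : ManifoldInterior (m + 1) cP.W,
      ∃ hmθ : MapsTo θCM ({(⟨y.1, y.2⟩ : cP.Interior)}ᶜ : Set _) ({y}ᶜ : Set _),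
      relativeSingularHomology.toLocal ℤ ℤ ((𝓡∂ (m + 1 + 1)).boundary cP.W)
          ⟨y.1, by rw [ModelWithCorners.compl_boundary]; exact y.2⟩ (m + 1 + 1) w =
        relativeSingularHomology.map ℤ ℤ
          (⟨Subtype.val, continuous_subtype_val⟩ : C(ManifoldInterior (m + 1) cP.W, cP.W))
          (LocalFamily.mapsTo_compl_pt Subtype.val_injective y) (m + 1 + 1)
          (relativeSingularHomology.map ℤ ℤ θCM hmθ (m + 1 + 1) (ν.localClass ⟨y.1, y.2⟩)) ∧
      relativeSingularHomology.map ℤ ℤ e (LocalFamily.mapsTo_compl_pt he.injective y) (m + 1 + 1)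
          (relativeSingularHomology.map ℤ ℤ θCM hmθ (m + 1 + 1) (ν.localClass ⟨y.1, y.2⟩)) =
        μ.localClass (e y) ∧
      singularHomology.toLocal ℤ ℤ (ClosedModel.ofInterior y) (m + 1 + 1)
          (cP.closedModelClass ℤ ℤ (Nat.le_add_left 1 m) w) =
        relativeSingularHomology.map ℤ ℤ (ofInteriorCM cP)
          (LocalFamily.mapsTo_compl_pt (isOpenEmbedding_ofInteriorCM cP).injective y) (m + 1 + 1)
          (relativeSingularHomology.map ℤ ℤ θCM hmθ (m + 1 + 1) (ν.localClass ⟨y.1, y.2⟩)) := by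
    intro y
    have hmθ : MapsTo θCM ({(⟨y.1, y.2⟩ : cP.Interior)}ᶜ : Set _) ({y}ᶜ : Set _) :=
      LocalFamily.mapsTo_compl_pt θ.injective (⟨y.1, y.2⟩ : cP.Interior)
    refine ⟨hmθ, ?_, ?_, ?_⟩
    · -- `w|_y = val_* ν_v = val_* θ_* ν_v` read on `ManifoldInterior`
      have s2 : relativeSingularHomology.toLocal ℤ ℤ ((𝓡∂ (m + 1 + 1)).boundary cP.W)
          ⟨y.1, by rw [ModelWithCorners.compl_boundary]; exact y.2⟩ (m + 1 + 1) w =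
          relativeSingularHomology.map ℤ ℤ cP.valCM (cP.mapsTo_val_compl_singleton ⟨y.1, y.2⟩)
            (m + 1 + 1) (ν.localClass ⟨y.1, y.2⟩) := hwloc ⟨y.1, y.2⟩
      rw [s2, relativeSingularHomology.map_congr_fun' (R := ℤ) hval.symm
        (cP.mapsTo_val_compl_singleton ⟨y.1, y.2⟩)
        ((LocalFamily.mapsTo_compl_pt Subtype.val_injective y).comp hmθ) (m + 1 + 1)]
      exact ConcreteCategory.congr_hom (relativeSingularHomology.map_comp ℤ ℤ θCM
        (⟨Subtype.val, continuous_subtype_val⟩ : C(ManifoldInterior (m + 1) cP.W, cP.W)) hmθ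
        (LocalFamily.mapsTo_compl_pt Subtype.val_injective y) (m + 1 + 1)) (ν.localClass ⟨y.1, y.2⟩)
    · -- `e_* θ_* ν_v = E_* ν_v = μ_{e y}`
      refine Eq.trans ?_ (hν ⟨y.1, y.2⟩)
      exact (ConcreteCategory.congr_hom (relativeSingularHomology.map_comp ℤ ℤ θCM e hmθ
        (LocalFamily.mapsTo_compl_pt he.injective y) (m + 1 + 1)) (ν.localClass ⟨y.1, y.2⟩)).symm
    · -- `ẑ_w|_y = q_* (w|_y) = q_* val_* ν_v = (q ∘ val)_* ν_v = ofInterior_* θ_* ν_v`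
      have hyint : (y.1 : cP.W) ∈ (𝓡∂ (m + 1 + 1)).interior cP.W := y.2
      have e2 : boundaryCollapse (m + 1) cP.W y.1 = ClosedModel.ofInterior y := by
        rw [boundaryCollapse_of_mem_interior hyint]; rfl
      have hfp : MapsTo ((boundaryCollapse (m + 1) cP.W).comp cP.valCM)
          ({(⟨y.1, y.2⟩ : cP.Interior)}ᶜ : Set _) ({boundaryCollapse (m + 1) cP.W y.1}ᶜ : Set _) :=
        (cP.mapsTo_boundaryCollapse_compl_singleton hyint).comp
          (cP.mapsTo_val_compl_singleton ⟨y.1, y.2⟩)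
      have hfq : MapsTo ((boundaryCollapse (m + 1) cP.W).comp cP.valCM)
          ({(⟨y.1, y.2⟩ : cP.Interior)}ᶜ : Set _) ({ClosedModel.ofInterior y}ᶜ : Set _) := by
        rw [← e2]; exact hfp
      have s1 := cP.toLocal_closedModelClass_of_mem_interior ℤ ℤ (Nat.le_add_left 1 m) w hyint
      have s2 := hwloc ⟨y.1, y.2⟩
      have s3 : singularHomology.toLocal ℤ ℤ (boundaryCollapse (m + 1) cP.W y.1)
          (m + 1 + 1) (cP.closedModelClass ℤ ℤ (Nat.le_add_left 1 m) w) =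
          relativeSingularHomology.map ℤ ℤ ((boundaryCollapse (m + 1) cP.W).comp cP.valCM) hfp
            (m + 1 + 1) (ν.localClass ⟨y.1, y.2⟩) := by
        rw [s1]
        erw [s2]
        exact (ConcreteCategory.congr_hom (relativeSingularHomology.map_comp ℤ ℤ cP.valCM
          (boundaryCollapse (m + 1) cP.W) (cP.mapsTo_val_compl_singleton ⟨y.1, y.2⟩)
          (cP.mapsTo_boundaryCollapse_compl_singleton hyint) (m + 1 + 1)) (ν.localClass ⟨y.1, y.2⟩)).symm
      have s4 := (singularHomology.toLocal_eq_map_iff_of_eq e2 (m + 1 + 1) _ _ hfp hfq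
        (ν.localClass ⟨y.1, y.2⟩)).1 s3
      have hfg : (boundaryCollapse (m + 1) cP.W).comp cP.valCM = (ofInteriorCM cP).comp θCM := by
        ext v' : 1
        exact boundaryCollapse_of_mem_interior v'.property
      rw [s4, relativeSingularHomology.map_congr_fun' (R := ℤ) hfg hfq
        ((LocalFamily.mapsTo_compl_pt (isOpenEmbedding_ofInteriorCM cP).injective y).comp hmθ)
        (m + 1 + 1)]
      exact ConcreteCategory.congr_hom (relativeSingularHomology.map_comp ℤ ℤ θCM (ofInteriorCM cP) hmθ
        (LocalFamily.mapsTo_compl_pt (isOpenEmbedding_ofInteriorCM cP).injective y)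
        (m + 1 + 1)) (ν.localClass ⟨y.1, y.2⟩)
  refine ⟨π, w, hπe, hπout, hmaps, hw, fun y => ?_, ?_⟩
  · obtain ⟨hmθ, h1, h2, h3⟩ := hkey y
    exact ⟨_, h1, h2, h3⟩
  · -- the transfer of the fundamental class
    refine htrans μ.fundamentalClass w fun y => ?_
    obtain ⟨hmθ, -, h2, h3⟩ := hkey y
    refine ⟨_, ?_, h3⟩
    rw [HomologicalOrientation.isFundamentalClass_fundamentalClass_holds (R := ℤ) (X := X)
      (m + 1 + 1) μ (e y)]
    exact h2.symm

end NullCobordism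

namespace SphereProd

variable {k m : ℕ} {hkm : k + k = m + 1 + 1} {c : ℝ} (hc : |c| < 1)

/-! ### The tube as a null-cobordism of its boundary -/


/-- The boundary `{⟪p, q⟫ = c}` of the tube is nonempty (`k ≥ 1`): e.g. `(e₀, c e₀ + √(1-c²) e₁)`.
[folklore] -/
theorem Tube.nonempty_boundary (hk : 1 ≤ k) :
    Nonempty ↥((𝓡∂ (m + 1 + 1)).boundary (Tube k (m + 1) hkm hc)) := by
  -- two orthonormal vectors `e₀`, `e₁`
  set e₀ : EuclideanSpace ℝ (Fin (k + 1)) := EuclideanSpace.single ⟨0, by omega⟩ 1 with he₀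
  set e₁ : EuclideanSpace ℝ (Fin (k + 1)) := EuclideanSpace.single ⟨1, by omega⟩ 1 with he₁
  have h01 : ⟪e₀, e₁⟫_ℝ = 0 := by
    rw [he₀, he₁, EuclideanSpace.inner_single_left]
    simp [Fin.ext_iff]
  have hn0 : ‖e₀‖ = 1 := by simp [he₀]
  have hn1 : ‖e₁‖ = 1 := by simp [he₁]
  set q : EuclideanSpace ℝ (Fin (k + 1)) := c • e₀ + Real.sqrt (1 - c ^ 2) • e₁ with hq
  have hc2 : 0 ≤ 1 - c ^ 2 := by nlinarith [abs_nonneg c, abs_lt.1 hc]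
  have hnq : ‖q‖ = 1 := by
    have h2 : ‖q‖ ^ 2 = 1 ^ 2 := by
      rw [hq, @norm_add_sq_real, norm_smul, norm_smul, hn0, hn1, real_inner_smul_left,
        real_inner_smul_right, h01]
      simp only [Real.norm_eq_abs, mul_one, mul_zero, add_zero, sq_abs, Real.sq_sqrt hc2, one_pow]
      ring
    exact (sq_eq_sq₀ (norm_nonneg _) zero_le_one).1 h2
  have hpq : ⟪e₀, q⟫_ℝ = c := by
    rw [hq, inner_add_right, real_inner_smul_right, real_inner_smul_right, h01,
      real_inner_self_eq_norm_sq, hn0, one_pow, mul_one, mul_zero, add_zero]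
  set p' : Metric.sphere (0 : EuclideanSpace ℝ (Fin (k + 1))) 1 := ⟨e₀, by simp [hn0]⟩ with hp'
  set q' : Metric.sphere (0 : EuclideanSpace ℝ (Fin (k + 1))) 1 := ⟨q, by simp [hnq]⟩ with hq'
  refine ⟨⟨Tube.ofProd hc (p', q') (by rw [hpq]), ?_⟩⟩
  rw [Tube.mem_boundary_iff, Tube.toProd_ofProd]
  exact hpq

/-- **The tube as a null-cobordism of its boundary** (a compact manifold with boundary is one,
`SmaleHomologySpheres.nullCobordismOfBoundary`); its total space is the tube itself.
[cite: MilnorHCobordism1965, §1] -/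
theorem Tube.nullCobordismOfBoundary_W :
    (SmaleHomologySpheres.nullCobordismOfBoundary (m + 1) (Tube k (m + 1) hkm hc)).W =
      Tube k (m + 1) hkm hc := rfl


/-! ### The collapse `Sᵏ × Sᵏ → N̂_c` and its surjectivity on `Hₖ` -/
set_option maxHeartbeats 400000 in -- buildfix (bf3-g27): 160k/180k FAIL, 200k PASS at accept time; line-neutral budget line
/-- **The collapse `π : Sᵏ × Sᵏ → N̂_c` is onto on `Hₖ`** (`k = j + 1 ≥ 2`), for any continuous
`π` which is the boundary collapse `q` on the tube and `∞` on `N' = {⟪p, q⟫ ≤ c}`: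
`Hₖ(Sᵏ × Sᵏ) → Hₖ(Sᵏ × Sᵏ, N')` is onto as `Hₖ₋₁(N') = 0` (`N' ≃ Sᵏ`,
`isZero_singularHomology_sublevel`), the inclusion of pairs `(N, ∂N) → (Sᵏ × Sᵏ, N')` followed by
`π` is `q : (N, ∂N) → (N̂, ∞)`, an isomorphism on relative homology (Hatcher Prop. 2.22,
`NullCobordism.isIso_map_boundaryCollapse_succ`), and `j_* : Hₖ(N̂) ≅ Hₖ(N̂, ∞)`.
[cite: HatcherAT2002, Prop. 2.22, Thm. 2.16] -/
theorem Tube.surjective_map_collapse {j : ℕ} {hkm : j + 1 + (j + 1) = m + 1 + 1} (hc : |c| < 1)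
    (hj : 1 ≤ j)
    (π : C(PM (j + 1) (m + 1) hkm, ClosedModel (m + 1) (Tube (j + 1) (m + 1) hkm hc)))
    (hπq : ∀ y : Tube (j + 1) (m + 1) hkm hc,
      π (RegularSublevel.incl _ y) = boundaryCollapse (m + 1) (Tube (j + 1) (m + 1) hkm hc) y)
    (hπN' : ∀ x : PM (j + 1) (m + 1) hkm, dotFn x ≤ c → π x = ClosedModel.infty)
    (η : singularHomology ℤ ℤ (ClosedModel (m + 1) (Tube (j + 1) (m + 1) hkm hc)) (j + 1)) :
    ∃ x : singularHomology ℤ ℤ (PM (j + 1) (m + 1) hkm) (j + 1),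
      singularHomology.map ℤ ℤ π (j + 1) x = η := by
  haveI : Nonempty ↥((𝓡∂ (m + 1 + 1)).boundary (Tube (j + 1) (m + 1) hkm hc)) :=
    Tube.nonempty_boundary hc (by omega)
  haveI : CompactSpace ↥((𝓡∂ (m + 1 + 1)).boundary (Tube (j + 1) (m + 1) hkm hc)) :=
    SmaleHomologySpheres.compactSpace_boundary (m + 1) (Tube (j + 1) (m + 1) hkm hc)
  obtain ⟨N', hN'⟩ : ∃ N' : Set (PM (j + 1) (m + 1) hkm), N' = dotFn ⁻¹' Iic c := ⟨_, rfl⟩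
  have hzero : IsZero (singularHomology ℤ ℤ ↥N' j) := by
    subst hN'
    exact isZero_singularHomology_sublevel (k := j + 1) (n := m + 1) (hkn := hkm) hc (j := j)
      (by omega) (by omega)
  -- maps of pairs
  have hπpair : MapsTo π N' ({ClosedModel.infty} : Set _) := fun x hx =>
    hπN' x (by rw [hN'] at hx; exact hx)
  obtain ⟨ι, hι⟩ : ∃ ι : C(Tube (j + 1) (m + 1) hkm hc, PM (j + 1) (m + 1) hkm),
      ι = ⟨RegularSublevel.incl _, RegularSublevel.continuous_incl _⟩ := ⟨_, rfl⟩
  have hιpair : MapsTo ι ((𝓡∂ (m + 1 + 1)).boundary (Tube (j + 1) (m + 1) hkm hc)) N' := by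
    intro y hy
    rw [RegularSublevel.mem_boundary_iff] at hy
    change c - dotFn (RegularSublevel.incl _ y) = 0 at hy
    rw [hN', hι]
    change dotFn (RegularSublevel.incl _ y) ≤ c
    linarith
  have hcomp : π.comp ι = boundaryCollapse (m + 1) (Tube (j + 1) (m + 1) hkm hc) := by
    ext y : 1; rw [hι]; exact hπq y
  -- the isomorphisms `q_*` and `j_*`
  haveI iq : IsIso (relativeSingularHomology.map ℤ ℤ
      (boundaryCollapse (m + 1) (Tube (j + 1) (m + 1) hkm hc))
      (mapsTo_boundaryCollapse (m + 1) (Tube (j + 1) (m + 1) hkm hc)) (j + 1)) :=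
    NullCobordism.isIso_map_boundaryCollapse_succ ℤ ℤ
      (SmaleHomologySpheres.nullCobordismOfBoundary (m + 1) (Tube (j + 1) (m + 1) hkm hc)) (j + 1)
  have hpt : ∀ i, i ≠ 0 → IsZero (singularHomology ℤ ℤ
      ↥({ClosedModel.infty} : Set (ClosedModel (m + 1) (Tube (j + 1) (m + 1) hkm hc))) i) :=
    fun i hi => isZero_singularHomology_of_subsingleton ℤ ℤ hi
  haveI ij : IsIso (relativeSingularHomology.ofAbsolute ℤ ℤ
      (ClosedModel (m + 1) (Tube (j + 1) (m + 1) hkm hc)) {ClosedModel.infty} (j + 1)) :=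
    isIso_ofAbsolute_of_isZero ℤ ℤ _ j (hpt _ (Nat.succ_ne_zero j)) (hpt _ (by omega))
  -- `H_{j+1}(PM) → H_{j+1}(PM, N')` is onto
  haveI : Epi (relativeSingularHomology.ofAbsolute ℤ ℤ (PM (j + 1) (m + 1) hkm) N' (j + 1)) :=
    (relativeSingularHomology.exact_ofAbsolute_δ ℤ ℤ N' j).epi_f (hzero.eq_of_tgt _ _)
  -- chase
  obtain ⟨θ, hθ⟩ : ∃ θ : relativeSingularHomology ℤ ℤ (Tube (j + 1) (m + 1) hkm hc)
      ((𝓡∂ (m + 1 + 1)).boundary (Tube (j + 1) (m + 1) hkm hc)) (j + 1),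
      θ = inv (relativeSingularHomology.map ℤ ℤ
        (boundaryCollapse (m + 1) (Tube (j + 1) (m + 1) hkm hc))
        (mapsTo_boundaryCollapse (m + 1) (Tube (j + 1) (m + 1) hkm hc)) (j + 1))
        (relativeSingularHomology.ofAbsolute ℤ ℤ _ {ClosedModel.infty} (j + 1) η) := ⟨_, rfl⟩
  obtain ⟨x, hx⟩ := (ModuleCat.epi_iff_surjective _).1
    (inferInstance : Epi (relativeSingularHomology.ofAbsolute ℤ ℤ (PM (j + 1) (m + 1) hkm) N' (j + 1)))
    (relativeSingularHomology.map ℤ ℤ ι hιpair (j + 1) θ)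
  refine ⟨x, ?_⟩
  apply (ModuleCat.mono_iff_injective (relativeSingularHomology.ofAbsolute ℤ ℤ
    (ClosedModel (m + 1) (Tube (j + 1) (m + 1) hkm hc)) {ClosedModel.infty} (j + 1))).1 inferInstance
  have h1 := congrArg (fun φ => (ModuleCat.Hom.hom φ) x)
    (relativeSingularHomology.ofAbsolute_comp_map ℤ ℤ π hπpair (j + 1))
  simp only [ModuleCat.hom_comp, LinearMap.comp_apply] at h1
  change relativeSingularHomology.ofAbsolute ℤ ℤ _ {ClosedModel.infty} (j + 1)
    (singularHomology.map ℤ ℤ π (j + 1) x) = _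
  rw [← h1]
  change relativeSingularHomology.map ℤ ℤ π hπpair (j + 1)
    (relativeSingularHomology.ofAbsolute ℤ ℤ (PM (j + 1) (m + 1) hkm) N' (j + 1) x) = _
  rw [hx, ← ModuleCat.comp_apply, ← relativeSingularHomology.map_comp]
  have hc' := relativeSingularHomology.map_congr_fun' (R := ℤ) hcomp (hπpair.comp hιpair)
    (mapsTo_boundaryCollapse (m + 1) (Tube (j + 1) (m + 1) hkm hc)) (j + 1)
  rw [ConcreteCategory.congr_hom hc' θ, hθ, ← ModuleCat.comp_apply, IsIso.inv_hom_id,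
    ModuleCat.id_apply]

set_option maxHeartbeats 800000 in
/-- **The collapse of `Sᵏ × Sᵏ` onto the closed model `N̂_c = N_c ∪ cone(∂N_c)` of the tube**
(Pontryagin–Thom collapse of the complementary open tube `{⟪p, q⟫ < c}`, here via
`NullCobordism.exists_ambientCollapse` for the open embedding of the interior `{⟪p, q⟫ > c}`):
a continuous `π : Sᵏ × Sᵏ → N̂_c` which agrees with the boundary collapse `q : N_c → N̂_c` on the
tube, is `∞` on `{⟪p, q⟫ ≤ c}`, and is **onto on `Hₖ`** (`k ≥ 2`): `Hₖ(Sᵏ × Sᵏ) → Hₖ(Sᵏ × Sᵏ, N')`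
is onto as `Hₖ₋₁(N') = 0` (`N' = {⟪p, q⟫ ≤ c} ≃ Sᵏ`), the inclusion of pairs `(N, ∂N) → (Sᵏ × Sᵏ, N')`
followed by `π` is `q : (N, ∂N) → (N̂, ∞)`, an isomorphism on relative homology (Hatcher
Prop. 2.22), and `j_* : Hₖ(N̂) ≅ Hₖ(N̂, ∞)`. It also transfers classes as in
`NullCobordism.exists_ambientCollapse`. [cite: KervaireMilnorAnnals1963, §7 footnote pp. 528–529] [cite: HatcherAT2002, Prop. 2.22, Thm. 2.16] -/
theorem Tube.exists_collapse (hk : 2 ≤ k) :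
    ∃ π : C(PM k (m + 1) hkm, ClosedModel (m + 1) (Tube k (m + 1) hkm hc)),
      (∀ y : Tube k (m + 1) hkm hc,
        π (RegularSublevel.incl _ y) = boundaryCollapse (m + 1) (Tube k (m + 1) hkm hc) y) ∧
      (∀ x : PM k (m + 1) hkm, dotFn x ≤ c → π x = ClosedModel.infty) ∧
      (∀ η : singularHomology ℤ ℤ (ClosedModel (m + 1) (Tube k (m + 1) hkm hc)) k,
        ∃ x : singularHomology ℤ ℤ (PM k (m + 1) hkm) k, singularHomology.map ℤ ℤ π k x = η) ∧
      (∀ y : ManifoldInterior (m + 1) (Tube k (m + 1) hkm hc),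
        MapsTo π ({(RegularSublevel.incl _ y.1 : PM k (m + 1) hkm)}ᶜ : Set _)
          ({ClosedModel.ofInterior y}ᶜ : Set _)) ∧
      ∀ (α : singularHomology ℤ ℤ (PM k (m + 1) hkm) (m + 1 + 1))
        (wP : relativeSingularHomology ℤ ℤ (Tube k (m + 1) hkm hc)
          ((𝓡∂ (m + 1 + 1)).boundary (Tube k (m + 1) hkm hc)) (m + 1 + 1)),
        (∀ y : ManifoldInterior (m + 1) (Tube k (m + 1) hkm hc),
          ∃ ζ : localHomology ℤ ℤ (ManifoldInterior (m + 1) (Tube k (m + 1) hkm hc)) y (m + 1 + 1),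
            singularHomology.toLocal ℤ ℤ (RegularSublevel.incl _ y.1 : PM k (m + 1) hkm) (m + 1 + 1) α =
              relativeSingularHomology.map ℤ ℤ
                (⟨fun y : ManifoldInterior (m + 1) (Tube k (m + 1) hkm hc) =>
                    (RegularSublevel.incl _ y.1 : PM k (m + 1) hkm),
                  (RegularSublevel.continuous_incl _).comp continuous_subtype_val⟩ : C(_, _))
                (LocalFamily.mapsTo_compl_pt (isOpenEmbedding_interior_tube (k := k) (n := m + 1) (hkn := hkm) hc).1.injective y)
                (m + 1 + 1) ζ ∧
            singularHomology.toLocal ℤ ℤ (ClosedModel.ofInterior y) (m + 1 + 1)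
                ((SmaleHomologySpheres.nullCobordismOfBoundary (m + 1)
                  (Tube k (m + 1) hkm hc)).closedModelClass ℤ ℤ (Nat.le_add_left 1 m) wP) =
              relativeSingularHomology.map ℤ ℤ (NullCobordism.ofInteriorCM
                  (SmaleHomologySpheres.nullCobordismOfBoundary (m + 1) (Tube k (m + 1) hkm hc)))
                (LocalFamily.mapsTo_compl_pt (NullCobordism.isOpenEmbedding_ofInteriorCM _).injective y)
                (m + 1 + 1) ζ) →
        singularHomology.map ℤ ℤ π (m + 1 + 1) α =
          (SmaleHomologySpheres.nullCobordismOfBoundary (m + 1)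
            (Tube k (m + 1) hkm hc)).closedModelClass ℤ ℤ (Nat.le_add_left 1 m) wP := by
  obtain ⟨j, rfl⟩ : ∃ j, k = j + 1 := ⟨k - 1, by omega⟩
  haveI : Nonempty ↥((𝓡∂ (m + 1 + 1)).boundary (Tube (j + 1) (m + 1) hkm hc)) :=
    Tube.nonempty_boundary hc (by omega)
  haveI : CompactSpace ↥((𝓡∂ (m + 1 + 1)).boundary (Tube (j + 1) (m + 1) hkm hc)) :=
    SmaleHomologySpheres.compactSpace_boundary (m + 1) (Tube (j + 1) (m + 1) hkm hc)
  -- the open embedding of the interior and the ambient collapse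
  have Hemb := isOpenEmbedding_interior_tube (k := j + 1) (n := m + 1) (hkn := hkm) hc
  have hemb := Hemb.1
  have hrange := Hemb.2
  -- (`obtain ⟨π, hπe, hπout, hmaps, htrans⟩` directly on this term makes `rcases` time out)
  have H := NullCobordism.exists_ambientCollapse (m := m)
    (X := PM (j + 1) (m + 1) hkm)
    (SmaleHomologySpheres.nullCobordismOfBoundary (m + 1) (Tube (j + 1) (m + 1) hkm hc))
    (⟨fun y : ManifoldInterior (m + 1) (Tube (j + 1) (m + 1) hkm hc) =>
        (RegularSublevel.incl _ y.1 : PM (j + 1) (m + 1) hkm),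
      (RegularSublevel.continuous_incl _).comp continuous_subtype_val⟩ : C(_, _)) hemb
  obtain ⟨π, hπ⟩ := H
  have hπe := hπ.1
  have hπout := hπ.2.1
  have hmaps := hπ.2.2.1
  have htrans := hπ.2.2.2
  have hrange' : range (fun y : ManifoldInterior (m + 1) (Tube (j + 1) (m + 1) hkm hc) =>
      (RegularSublevel.incl _ y.1 : PM (j + 1) (m + 1) hkm)) = {x : PM (j + 1) (m + 1) hkm | c < dotFn x} :=
    hrange
  -- `π = q` on the tube
  have hπq : ∀ y : Tube (j + 1) (m + 1) hkm hc,
      π (RegularSublevel.incl _ y) = boundaryCollapse (m + 1) (Tube (j + 1) (m + 1) hkm hc) y := by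
    intro y
    by_cases hy : c < dotFn (RegularSublevel.incl _ y)
    · have hint : y ∈ (𝓡∂ (m + 1 + 1)).interior (Tube (j + 1) (m + 1) hkm hc) := by
        change (𝓡∂ (m + 1 + 1)).IsInteriorPoint y
        rw [RegularSublevel.isInteriorPoint_iff, sub_neg]; exact hy
      rw [boundaryCollapse_of_mem_interior hint]
      exact hπe ⟨y, hint⟩
    · have hbd : y ∈ (𝓡∂ (m + 1 + 1)).boundary (Tube (j + 1) (m + 1) hkm hc) := by
        rw [RegularSublevel.mem_boundary_iff]
        have hle : dotFn (RegularSublevel.incl _ y) ≤ c := not_lt.1 hy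
        have hge := y.2
        change c - dotFn (RegularSublevel.incl _ y) ≤ 0 at hge
        change c - dotFn (RegularSublevel.incl _ y) = 0
        linarith
      rw [boundaryCollapse_of_mem_boundary hbd]
      apply hπout
      change RegularSublevel.incl _ y ∉ range (fun y : ManifoldInterior (m + 1) (Tube (j + 1) (m + 1) hkm hc) =>
        (RegularSublevel.incl _ y.1 : PM (j + 1) (m + 1) hkm))
      rw [hrange']
      exact hy
  have hπN' : ∀ x : PM (j + 1) (m + 1) hkm, dotFn x ≤ c → π x = ClosedModel.infty := fun x hx =>
    hπout x (by
      change x ∉ range (fun y : ManifoldInterior (m + 1) (Tube (j + 1) (m + 1) hkm hc) =>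
        (RegularSublevel.incl _ y.1 : PM (j + 1) (m + 1) hkm))
      rw [hrange']; exact not_lt.2 hx)
  exact ⟨π, hπq, hπN', fun η => Tube.surjective_map_collapse hc (by omega) π hπq hπN' η,
    fun y => hmaps y, fun α wP hloc => htrans α wP hloc⟩


set_option maxHeartbeats 800000 in
/-- **The collapse of `Sᵏ × Sᵏ` carries `[Sᵏ × Sᵏ]_μ` to the closed-model class of the tube.**
For `k ≥ 2` and a `ℤ`-orientation `μ` of `Sᵏ × Sᵏ` (re-charted, `PM`) there are the collapse
`π : Sᵏ × Sᵏ → N̂_c` of `Tube.exists_collapse` (the boundary collapse on the tube, `∞` on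
`{⟪p, q⟫ ≤ c}`, onto on `Hₖ`) and a relative fundamental class `w ∈ Hₙ(N_c, ∂N_c; ℤ)`
(`n = m + 2 = 2k`) of the tube INDUCED BY `μ` — the inclusion `N_c ⊆ Sᵏ × Sᵏ` carries its local
class at every interior point `y` to `μ_y` — with `π_* [Sᵏ × Sᵏ]_μ = ẑ_w`
(`NullCobordism.exists_collapse_fundamentalClass` for the open embedding of the interior of the
tube, `isOpenEmbedding_interior_tube`). With the Kronecker numbers of the Thom class
(`SphereProductThomKronecker.lean`) this makes the vertex data of the `E₈` table
(`HomotopySpheresE8KroneckerTable.lean`) computable in one oriented copy of `S²ᵐ × S²ᵐ`.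
[cite: Kosinski1993, VI.12 pp. 119–122] [cite: HatcherAT2002, §3.3 Thm. 3.26(a), p. 253] -/
theorem Tube.exists_collapse_fundamentalClass (hk : 2 ≤ k)
    (μ : HomologicalOrientation ℤ (PM k (m + 1) hkm) (m + 1 + 1)) :
    ∃ (π : C(PM k (m + 1) hkm, ClosedModel (m + 1) (Tube k (m + 1) hkm hc)))
      (w : relativeSingularHomology ℤ ℤ (Tube k (m + 1) hkm hc)
        ((𝓡∂ (m + 1 + 1)).boundary (Tube k (m + 1) hkm hc)) (m + 1 + 1)),
      (∀ y : Tube k (m + 1) hkm hc,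
        π (RegularSublevel.incl _ y) = boundaryCollapse (m + 1) (Tube k (m + 1) hkm hc) y) ∧
      (∀ x : PM k (m + 1) hkm, dotFn x ≤ c → π x = ClosedModel.infty) ∧
      (∀ η : singularHomology ℤ ℤ (ClosedModel (m + 1) (Tube k (m + 1) hkm hc)) k,
        ∃ x : singularHomology ℤ ℤ (PM k (m + 1) hkm) k, singularHomology.map ℤ ℤ π k x = η) ∧
      IsRelFundamentalClass ℤ ((𝓡∂ (m + 1 + 1)).boundary (Tube k (m + 1) hkm hc)) w ∧
      (∀ y : ManifoldInterior (m + 1) (Tube k (m + 1) hkm hc),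
        relativeSingularHomology.map ℤ ℤ
            (⟨RegularSublevel.incl _, RegularSublevel.continuous_incl _⟩ :
              C(Tube k (m + 1) hkm hc, PM k (m + 1) hkm))
            (LocalFamily.mapsTo_compl_pt Subtype.val_injective y.1) (m + 1 + 1)
            (relativeSingularHomology.toLocal ℤ ℤ ((𝓡∂ (m + 1 + 1)).boundary (Tube k (m + 1) hkm hc))
              ⟨y.1, by rw [ModelWithCorners.compl_boundary]; exact y.2⟩ (m + 1 + 1) w) =
          μ.localClass (RegularSublevel.incl _ y.1)) ∧
      (∀ y : ManifoldInterior (m + 1) (Tube k (m + 1) hkm hc),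
        ∃ ζ : localHomology ℤ ℤ (ManifoldInterior (m + 1) (Tube k (m + 1) hkm hc)) y (m + 1 + 1),
          relativeSingularHomology.map ℤ ℤ
              (⟨fun y : ManifoldInterior (m + 1) (Tube k (m + 1) hkm hc) =>
                  (RegularSublevel.incl _ y.1 : PM k (m + 1) hkm),
                (RegularSublevel.continuous_incl _).comp continuous_subtype_val⟩ : C(_, _))
              (LocalFamily.mapsTo_compl_pt
                (isOpenEmbedding_interior_tube (k := k) (n := m + 1) (hkn := hkm) hc).1.injective y)
              (m + 1 + 1) ζ = μ.localClass (RegularSublevel.incl _ y.1) ∧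
          singularHomology.toLocal ℤ ℤ (ClosedModel.ofInterior y) (m + 1 + 1)
              ((SmaleHomologySpheres.nullCobordismOfBoundary (m + 1)
                (Tube k (m + 1) hkm hc)).closedModelClass ℤ ℤ (Nat.le_add_left 1 m) w) =
            relativeSingularHomology.map ℤ ℤ (NullCobordism.ofInteriorCM
                (SmaleHomologySpheres.nullCobordismOfBoundary (m + 1) (Tube k (m + 1) hkm hc)))
              (LocalFamily.mapsTo_compl_pt (NullCobordism.isOpenEmbedding_ofInteriorCM _).injective y)
              (m + 1 + 1) ζ) ∧
      singularHomology.map ℤ ℤ π (m + 1 + 1) μ.fundamentalClass =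
        (SmaleHomologySpheres.nullCobordismOfBoundary (m + 1)
          (Tube k (m + 1) hkm hc)).closedModelClass ℤ ℤ (Nat.le_add_left 1 m) w := by
  haveI : Nonempty ↥((𝓡∂ (m + 1 + 1)).boundary (Tube k (m + 1) hkm hc)) :=
    Tube.nonempty_boundary hc (by omega)
  haveI : CompactSpace ↥((𝓡∂ (m + 1 + 1)).boundary (Tube k (m + 1) hkm hc)) :=
    SmaleHomologySpheres.compactSpace_boundary (m + 1) (Tube k (m + 1) hkm hc)
  -- the collapse of `Tube.exists_collapse` (onto on `Hₖ`)
  have Hπ := Tube.exists_collapse (k := k) (m := m) (hkm := hkm) hc hk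
  obtain ⟨π, hπ⟩ := Hπ
  have hπq := hπ.1
  have hπN := hπ.2.1
  have hsurj := hπ.2.2.1
  -- the open embedding of the interior
  have Hemb := isOpenEmbedding_interior_tube (k := k) (n := m + 1) (hkn := hkm) hc
  have hemb := Hemb.1
  have hrange := Hemb.2
  let eCM : C(ManifoldInterior (m + 1) (Tube k (m + 1) hkm hc), PM k (m + 1) hkm) :=
    ⟨fun y : ManifoldInterior (m + 1) (Tube k (m + 1) hkm hc) =>
        (RegularSublevel.incl _ y.1 : PM k (m + 1) hkm),
      (RegularSublevel.continuous_incl _).comp continuous_subtype_val⟩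
  -- the generic theorem, for the tube as a null-cobordism of its boundary
  have H := (SmaleHomologySpheres.nullCobordismOfBoundary (m + 1) (Tube k (m + 1) hkm hc)).exists_collapse_fundamentalClass μ eCM hemb
  obtain ⟨π', w, hH⟩ := H
  have hπe := hH.1
  have hπout := hH.2.1
  have hw := hH.2.2.2.1
  have hL := hH.2.2.2.2.1
  have hclass := hH.2.2.2.2.2
  -- the two collapses agree
  have hππ : π' = π := by
    ext x : 1
    by_cases hx : x ∈ range eCM
    · obtain ⟨y, rfl⟩ := hx
      refine (hπe y).trans ?_
      refine Eq.trans ?_ (hπq y.1).symm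
      exact (boundaryCollapse_of_mem_interior y.2).symm
    · refine (hπout x hx).trans ?_
      refine (hπN x (not_lt.1 fun hlt => hx ?_)).symm
      have : x ∈ {x : PM k (m + 1) hkm | c < dotFn x} := hlt
      rw [← hrange] at this
      exact this
  refine ⟨π, w, hπq, hπN, hsurj, hw, fun y => ?_, fun y => ?_, hππ ▸ hclass⟩
  swap
  · obtain ⟨ζ, -, h2, h3⟩ := hL y
    exact ⟨ζ, h2, h3⟩
  -- the local classes of `w`, through the interior
  obtain ⟨ζ, h1, h2, -⟩ := hL y
  have h1' : relativeSingularHomology.toLocal ℤ ℤ ((𝓡∂ (m + 1 + 1)).boundary (Tube k (m + 1) hkm hc))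
      ⟨y.1, by rw [ModelWithCorners.compl_boundary]; exact y.2⟩ (m + 1 + 1) w =
      relativeSingularHomology.map ℤ ℤ
        (⟨Subtype.val, continuous_subtype_val⟩ :
          C(ManifoldInterior (m + 1) (Tube k (m + 1) hkm hc), Tube k (m + 1) hkm hc))
        (LocalFamily.mapsTo_compl_pt Subtype.val_injective y) (m + 1 + 1) ζ := h1
  rw [h1']
  refine Eq.trans ?_ h2
  have heq : (⟨RegularSublevel.incl _, RegularSublevel.continuous_incl _⟩ :
      C(Tube k (m + 1) hkm hc, PM k (m + 1) hkm)).comp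
      (⟨Subtype.val, continuous_subtype_val⟩ :
        C(ManifoldInterior (m + 1) (Tube k (m + 1) hkm hc), Tube k (m + 1) hkm hc)) = eCM := by
    ext y' : 1; rfl
  exact ((ConcreteCategory.congr_hom (relativeSingularHomology.map_comp ℤ ℤ
    (⟨Subtype.val, continuous_subtype_val⟩ :
      C(ManifoldInterior (m + 1) (Tube k (m + 1) hkm hc), Tube k (m + 1) hkm hc))
    (⟨RegularSublevel.incl _, RegularSublevel.continuous_incl _⟩ :
      C(Tube k (m + 1) hkm hc, PM k (m + 1) hkm))
    (LocalFamily.mapsTo_compl_pt Subtype.val_injective y)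
    (LocalFamily.mapsTo_compl_pt Subtype.val_injective y.1) (m + 1 + 1)) ζ).symm.trans
    (ConcreteCategory.congr_hom (relativeSingularHomology.map_congr_fun' (R := ℤ) heq
      ((LocalFamily.mapsTo_compl_pt Subtype.val_injective y.1).comp
        (LocalFamily.mapsTo_compl_pt Subtype.val_injective y))
      (LocalFamily.mapsTo_compl_pt hemb.injective y) (m + 1 + 1)) ζ))


end SphereProd

end Literature.Topology.FourManifolds

end
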